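import Summits.Ventures.LatticeQCDFlow.Exactness.IMHColdStartTwoTime
import Summits.Ventures.LatticeQCDFlow.Exactness.IMHColdStartDiscard
import Summits.Ventures.LatticeQCDFlow.Exactness.MetropolisSweepConvergence
import Summits.Ventures.LatticeQCDFlow.Scoring.ChainPathLaw
import HarnessLib

/-!
# The cold start at every order: after `b` discarded updates the WHOLE recorded stream of flow-MCMC started
# at a mode is exactly the mixture `(1 − r^b)·(equilibrium run) + r^b·(cold-started run)`

HONEST FRAMING: exact (Metropolis-corrected) sampling algorithms for lattice gauge theory;
figures of merit are autocorrelation/cost numbers at stated couplings and volumes; no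
continuum-physics claim.

Venture `LatticeQCDFlow` (cell pub-lqcd), topic `Exactness`; FANOUT row 30 (lean-1, GEN-33).  NEW WORK of the
cell, general state space.  GEN-31 computed the ONE-TIME laws of the flow-MCMC chain `K = indepMH q w` (proposal
`q`, normalised weight `w = dπ/dq`, `π = w·q`) started at a mode `x₀` of `w` (`δ_{x₀}K^t = (1 − r^t)·π + r^t·δ_{x₀}`,
`r = 1 − 1/w(x₀)`, `Exactness/IMHModeRenewal`), GEN-32 the TWO-TIME laws and the exact second-order price of the
cold start for ONE statistic, the time average (`Exactness/IMHColdStartTwoTime`, `…MSE`, `…WindowMSE`: discarding `b`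
updates multiplies that price by `r^b`).  This file settles the question for EVERY statistic of the run at once, at
the level of LAWS ON PATH SPACE (Mathlib's Ionescu-Tulcea measure `Kernel.trajMeasure`; the Scoring row's path-level
Markov property `Scoring/ChainPathLaw.chain_map_shift`):

* §1 bookkeeping for a general Markov kernel `κ`: **`chain_add_smul`** — the chain law is affine in the initial
  law, `P_{a·μ + b·ν} = a·P_μ + b·P_ν`; **`chain_map_eval`** — the time-`s` marginal of `P_{μ₀}` is the measure
  `μ₀K^s` (measure form of `IMHColdStartPathAverage.chain_expect_eq_integral_iterate_bind`); **`chain_map_shift_eq`**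
  — the `s`-shifted stream is the chain from `μ₀K^s`.
* §2 **`imh_chain_shift_mode`** — THE PATH LAW AFTER `b` DISCARDED UPDATES: for `w` measurable, positive,
  normalised, maximal at `x₀`, the image of `P_{x₀}` under the shift `x ↦ (n ↦ x (b + n))` is EXACTLY
  `(1 − r^b)·P_π + r^b·P_{x₀}` — with probability `1 − r^b` the stream recorded after the burn-in IS an equilibrium
  run, with probability `r^b` it IS a cold-started run; nothing in between, at the level of the whole future.
* §3 **`imh_chain_shift_integral_mode`** — hence for EVERY bounded measurable path statistic `F` (acceptance
  fractions, histograms, autocovariance and `τ_int` estimators, error bars, quantiles of the run …):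
  `E_{x₀}[F(X_{b+·})] = (1 − r^b)·E_π[F] + r^b·E_{x₀}[F]`, i.e. (**`imh_chain_shift_integral_mode_sub_stationary`**)
  `E_{x₀}[F(X_{b+·})] − E_π[F] = r^b·(E_{x₀}[F] − E_π[F])` EXACTLY: DISCARDING `b` UPDATES MULTIPLIES THE
  COLD-START DISTORTION OF EVERY STATISTIC BY `r^b = (1 − 1/w(x₀))^b` — GEN-31's discard law (one observable) and
  GEN-32's window law (the mean-square error) are the first two instances; two-sided envelope
  **`imh_chain_shift_integral_mode_abs_le`** (`≤ r^b·2C`) and the burn-in rule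
  **`imh_chain_shift_integral_mode_abs_le_of_log_le`**: `log(1/ε) ≤ b/w(x₀)` ⇒ `|E_{x₀}[F(X_{b+·})] − E_π[F]| ≤
  ε·|E_{x₀}[F] − E_π[F]|`.
* §4 set form and THE EXACT TOTAL VARIATION ON PATH SPACE: **`imh_chain_shift_real_mode_sub_stationary`** —
  `P_{x₀}(X_{b+·} ∈ E) − P_π(E) = r^b·(P_{x₀}(E) − P_π(E))` for every measurable set of paths `E`, so
  (**`imh_chain_shift_real_mode_abs_le`**) `|P_{x₀}(X_{b+·} ∈ E) − P_π(E)| ≤ r^b`, and with an atom-free proposal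
  (`q{x₀} = 0`) the bound is ATTAINED at `E = {X_0 = x₀}` (**`imh_chain_shift_atMode_sub_stationary`**): the law of
  the whole future after `b` discarded updates is EXACTLY as far from the equilibrium run, in total variation, as
  the current configuration is from `π` (GEN-31's one-time `r^b`) — the future carries no further memory.

Reading (gauge files `Scaling/AutoregressiveGauge…PathMixture`): with `r = 1 − A`, `A = Z/(c^{#B}M^k)` resp.
`Z/∏_ℓ c_{#C_ℓ}`, every statistic a seat computes from a cold-started exact gauge sampler after discarding `b`
configurations is, in expectation, the equilibrium value plus exactly `(1 − A)^b` times its full cold-start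
distortion; `b·A ≥ log(1/ε)` discarded configurations leave an `ε`-fraction of it, for all statistics at once.
NOT CLAIMED: the size of `E_{x₀}[F] − E_π[F]` for a particular statistic (GEN-31/32 computed it for time averages,
acceptance fractions and lag products); anything from a non-modal start (there the shifted law is `P_{δ_x K^b}` with
no two-point structure); the thaw decomposition of `P_{x₀}` itself (next file).

No `sorry`, no new definitions, nothing cited as a fact; general measurable space with measurable singletons.
-/

noncomputable section

namespace Summit.Ventures.LatticeQCDFlow.Exactness

open MeasureTheory ProbabilityTheory Function Finset
open scoped ENNReal
open Summit.Ventures.LatticeQCDFlow.Scoring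

variable {Ω : Type*} [MeasurableSpace Ω]

/-! ## §1 Bookkeeping: the chain law is affine in the initial law; marginals and shifts as measures -/

/-- **The chain law is affine in the initial law**: `P_{a·μ + b·ν} = a·P_μ + b·P_ν` for every Markov kernel and
all `a, b ∈ [0, ∞]` (Mathlib's `trajMeasure` is the composition of the initial law with ONE kernel into path
space). [ours, bookkeeping] -/
theorem chain_add_smul (κ : Kernel Ω Ω) [IsMarkovKernel κ] (μ ν : Measure Ω) (a b : ℝ≥0∞) :
    Kernel.trajMeasure (X := fun _ : ℕ => Ω) (a • μ + b • ν)
        (fun n : ℕ => κ.comap (fun h : (i : ↥(Finset.Iic n)) → Ω => h ⟨n, Finset.mem_Iic.2 le_rfl⟩)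
          (measurable_pi_apply _)) =
      a • Kernel.trajMeasure (X := fun _ : ℕ => Ω) μ
          (fun n : ℕ => κ.comap (fun h : (i : ↥(Finset.Iic n)) → Ω => h ⟨n, Finset.mem_Iic.2 le_rfl⟩)
            (measurable_pi_apply _)) +
        b • Kernel.trajMeasure (X := fun _ : ℕ => Ω) ν
          (fun n : ℕ => κ.comap (fun h : (i : ↥(Finset.Iic n)) → Ω => h ⟨n, Finset.mem_Iic.2 le_rfl⟩)
            (measurable_pi_apply _)) := by
  unfold Kernel.trajMeasure
  rw [Measure.map_add _ _ (MeasurableEquiv.measurable _), Measure.map_smul, Measure.map_smul]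
  ext s hs
  rw [Measure.bind_apply hs (Kernel.aemeasurable _), Measure.add_apply, Measure.smul_apply, Measure.smul_apply,
    Measure.bind_apply hs (Kernel.aemeasurable _), Measure.bind_apply hs (Kernel.aemeasurable _),
    lintegral_add_measure, lintegral_smul_measure, lintegral_smul_measure]

/-- **The time-`s` marginal of the chain law is the measure `μ₀K^s`**:
`P_{μ₀}.map (x ↦ x s) = (m ↦ mK)^[s] μ₀`. [ours, bookkeeping] -/
theorem chain_map_eval (κ : Kernel Ω Ω) [IsMarkovKernel κ] (μ₀ : Measure Ω) [IsProbabilityMeasure μ₀] (s : ℕ) :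
    (Kernel.trajMeasure (X := fun _ : ℕ => Ω) μ₀
        (fun n : ℕ => κ.comap (fun h : (i : ↥(Finset.Iic n)) → Ω => h ⟨n, Finset.mem_Iic.2 le_rfl⟩)
          (measurable_pi_apply _))).map (fun x : ℕ → Ω => x s) =
      (fun m : Measure Ω => m.bind κ)^[s] μ₀ := by
  haveI := isProbabilityMeasure_iterate_bind (κ := κ) μ₀ s
  ext B hB
  rw [← measureReal_eq_measureReal_iff (measure_ne_top _ _) (measure_ne_top _ _),
    map_measureReal_apply (measurable_pi_apply s) hB,
    ← integral_indicator_one ((measurable_pi_apply s) hB), ← integral_indicator_one hB]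
  have hb : ∀ x, |B.indicator (1 : Ω → ℝ) x| ≤ 1 := fun x => by
    by_cases hx : x ∈ B
    · rw [Set.indicator_of_mem hx, Pi.one_apply, abs_one]
    · rw [Set.indicator_of_notMem hx, abs_zero]; exact zero_le_one
  exact chain_expect_eq_integral_iterate_bind κ μ₀ (f := B.indicator 1) (measurable_one.indicator hB) hb s

/-- **The `s`-shifted stream is the chain from `μ₀K^s`** (the Scoring row's `chain_map_shift` with the marginal
named). [ours, bookkeeping] -/
theorem chain_map_shift_eq (κ : Kernel Ω Ω) [IsMarkovKernel κ] (μ₀ : Measure Ω) [IsProbabilityMeasure μ₀]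
    (s : ℕ) :
    (Kernel.trajMeasure (X := fun _ : ℕ => Ω) μ₀
        (fun n : ℕ => κ.comap (fun h : (i : ↥(Finset.Iic n)) → Ω => h ⟨n, Finset.mem_Iic.2 le_rfl⟩)
          (measurable_pi_apply _))).map (fun (x : ℕ → Ω) (n : ℕ) => x (s + n)) =
      Kernel.trajMeasure (X := fun _ : ℕ => Ω) ((fun m : Measure Ω => m.bind κ)^[s] μ₀)
        (fun n : ℕ => κ.comap (fun h : (i : ↥(Finset.Iic n)) → Ω => h ⟨n, Finset.mem_Iic.2 le_rfl⟩)
          (measurable_pi_apply _)) := by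
  rw [chain_map_shift κ μ₀ s, chain_map_eval κ μ₀ s]

/-- `|∫ F dP| ≤ C` for a path statistic with `|F| ≤ C` under any probability law on paths. [ours, bookkeeping] -/
theorem abs_integral_path_le (P : Measure (ℕ → Ω)) [IsProbabilityMeasure P] {F : (ℕ → Ω) → ℝ} {C : ℝ}
    (hC : ∀ x, |F x| ≤ C) : |∫ x, F x ∂P| ≤ C := by
  have h := norm_integral_le_of_norm_le_const (μ := P) (f := F) (C := C)
    (Filter.Eventually.of_forall fun x => by rw [Real.norm_eq_abs]; exact hC x)
  rwa [Real.norm_eq_abs, probReal_univ, mul_one] at h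

/-! ## §2 Flow-MCMC from a mode: the law of the shifted stream is the exact two-point mixture -/

variable [MeasurableSingletonClass Ω] {q : Measure Ω} [IsProbabilityMeasure q] {w : Ω → ℝ}

omit [MeasurableSingletonClass Ω] in
/-- **THE PATH LAW AFTER `b` DISCARDED UPDATES.**  `w` measurable (a `Fact`), positive, normalised, maximal at
`x₀`; `r = 1 − 1/w(x₀)`.  The image of the cold-started chain law `P_{x₀}` under the shift `x ↦ (n ↦ x (b + n))` is
EXACTLY `(1 − r^b)·P_π + r^b·P_{x₀}`. [ours] -/
theorem imh_chain_shift_mode [Fact (Measurable w)] (hw0 : ∀ y, 0 < w y) {x₀ : Ω} (hmax : ∀ y, w y ≤ w x₀)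
    [IsProbabilityMeasure (q.withDensity fun y => ENNReal.ofReal (w y))] (b : ℕ) :
    (Kernel.trajMeasure (X := fun _ : ℕ => Ω) (Measure.dirac x₀)
        (fun n : ℕ => (indepMH q w).comap (fun h : (i : ↥(Finset.Iic n)) → Ω => h ⟨n, Finset.mem_Iic.2 le_rfl⟩)
          (measurable_pi_apply _))).map (fun (x : ℕ → Ω) (n : ℕ) => x (b + n)) =
      ENNReal.ofReal (1 - (1 - (w x₀)⁻¹) ^ b) •
          Kernel.trajMeasure (X := fun _ : ℕ => Ω) (q.withDensity fun y => ENNReal.ofReal (w y))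
            (fun n : ℕ => (indepMH q w).comap (fun h : (i : ↥(Finset.Iic n)) → Ω => h ⟨n, Finset.mem_Iic.2 le_rfl⟩)
              (measurable_pi_apply _)) +
        ENNReal.ofReal ((1 - (w x₀)⁻¹) ^ b) •
          Kernel.trajMeasure (X := fun _ : ℕ => Ω) (Measure.dirac x₀)
            (fun n : ℕ => (indepMH q w).comap (fun h : (i : ↥(Finset.Iic n)) → Ω => h ⟨n, Finset.mem_Iic.2 le_rfl⟩)
              (measurable_pi_apply _)) := by
  rw [chain_map_shift_eq (indepMH q w) (Measure.dirac x₀) b, iterate_bind_indepMH_dirac_mode_eq Fact.out hw0 hmax b,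
    chain_add_smul]

/-! ## §3 Every statistic: discarding `b` updates multiplies the cold-start distortion by `r^b` -/

omit [MeasurableSingletonClass Ω] in
/-- **EVERY BOUNDED MEASURABLE PATH STATISTIC, EXACTLY**: `E_{x₀}[F(X_{b+·})] = (1 − r^b)·E_π[F] + r^b·E_{x₀}[F]`.
[ours] -/
theorem imh_chain_shift_integral_mode [Fact (Measurable w)] (hw0 : ∀ y, 0 < w y) {x₀ : Ω}
    (hmax : ∀ y, w y ≤ w x₀) [IsProbabilityMeasure (q.withDensity fun y => ENNReal.ofReal (w y))]
    {F : (ℕ → Ω) → ℝ} (hF : Measurable F) {C : ℝ} (hC : ∀ x, |F x| ≤ C) (b : ℕ) :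
    ∫ x, F (fun n => x (b + n)) ∂(Kernel.trajMeasure (X := fun _ : ℕ => Ω) (Measure.dirac x₀)
        (fun n : ℕ => (indepMH q w).comap (fun h : (i : ↥(Finset.Iic n)) → Ω => h ⟨n, Finset.mem_Iic.2 le_rfl⟩)
          (measurable_pi_apply _))) =
      (1 - (1 - (w x₀)⁻¹) ^ b) *
          ∫ x, F x ∂(Kernel.trajMeasure (X := fun _ : ℕ => Ω) (q.withDensity fun y => ENNReal.ofReal (w y))
            (fun n : ℕ => (indepMH q w).comap (fun h : (i : ↥(Finset.Iic n)) → Ω => h ⟨n, Finset.mem_Iic.2 le_rfl⟩)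
              (measurable_pi_apply _))) +
        (1 - (w x₀)⁻¹) ^ b *
          ∫ x, F x ∂(Kernel.trajMeasure (X := fun _ : ℕ => Ω) (Measure.dirac x₀)
            (fun n : ℕ => (indepMH q w).comap (fun h : (i : ↥(Finset.Iic n)) → Ω => h ⟨n, Finset.mem_Iic.2 le_rfl⟩)
              (measurable_pi_apply _))) := by
  have hW : 1 ≤ w x₀ := one_le_of_mode (q := q) hmax
  have hr0 : 0 ≤ 1 - (w x₀)⁻¹ := sub_nonneg.2 (inv_le_one_of_one_le₀ hW)
  have hr1 : 1 - (w x₀)⁻¹ ≤ 1 := sub_le_self _ (inv_nonneg.mpr (hw0 x₀).le)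
  have hc0 : 0 ≤ 1 - (1 - (w x₀)⁻¹) ^ b := sub_nonneg.2 (pow_le_one₀ hr0 hr1)
  have hΘ : Measurable (fun (x : ℕ → Ω) (n : ℕ) => x (b + n)) :=
    measurable_pi_lambda _ fun n => measurable_pi_apply _
  rw [← integral_map hΘ.aemeasurable hF.aestronglyMeasurable, imh_chain_shift_mode hw0 hmax b,
    integral_add_measure, integral_smul_measure, integral_smul_measure, ENNReal.toReal_ofReal hc0,
    ENNReal.toReal_ofReal (pow_nonneg hr0 b), smul_eq_mul, smul_eq_mul]
  · exact (integrable_of_bounded _ hF hC).smul_measure ENNReal.ofReal_ne_top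
  · exact (integrable_of_bounded _ hF hC).smul_measure ENNReal.ofReal_ne_top

omit [MeasurableSingletonClass Ω] in
/-- **DISCARDING `b` UPDATES MULTIPLIES THE COLD-START DISTORTION OF EVERY STATISTIC BY EXACTLY `r^b`**:
`E_{x₀}[F(X_{b+·})] − E_π[F] = r^b·(E_{x₀}[F] − E_π[F])`. [ours] -/
theorem imh_chain_shift_integral_mode_sub_stationary [Fact (Measurable w)] (hw0 : ∀ y, 0 < w y) {x₀ : Ω}
    (hmax : ∀ y, w y ≤ w x₀) [IsProbabilityMeasure (q.withDensity fun y => ENNReal.ofReal (w y))]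
    {F : (ℕ → Ω) → ℝ} (hF : Measurable F) {C : ℝ} (hC : ∀ x, |F x| ≤ C) (b : ℕ) :
    ∫ x, F (fun n => x (b + n)) ∂(Kernel.trajMeasure (X := fun _ : ℕ => Ω) (Measure.dirac x₀)
        (fun n : ℕ => (indepMH q w).comap (fun h : (i : ↥(Finset.Iic n)) → Ω => h ⟨n, Finset.mem_Iic.2 le_rfl⟩)
          (measurable_pi_apply _))) -
      ∫ x, F x ∂(Kernel.trajMeasure (X := fun _ : ℕ => Ω) (q.withDensity fun y => ENNReal.ofReal (w y))
        (fun n : ℕ => (indepMH q w).comap (fun h : (i : ↥(Finset.Iic n)) → Ω => h ⟨n, Finset.mem_Iic.2 le_rfl⟩)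
          (measurable_pi_apply _))) =
      (1 - (w x₀)⁻¹) ^ b *
        (∫ x, F x ∂(Kernel.trajMeasure (X := fun _ : ℕ => Ω) (Measure.dirac x₀)
            (fun n : ℕ => (indepMH q w).comap (fun h : (i : ↥(Finset.Iic n)) → Ω => h ⟨n, Finset.mem_Iic.2 le_rfl⟩)
              (measurable_pi_apply _))) -
          ∫ x, F x ∂(Kernel.trajMeasure (X := fun _ : ℕ => Ω) (q.withDensity fun y => ENNReal.ofReal (w y))
            (fun n : ℕ => (indepMH q w).comap (fun h : (i : ↥(Finset.Iic n)) → Ω => h ⟨n, Finset.mem_Iic.2 le_rfl⟩)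
              (measurable_pi_apply _)))) := by
  rw [imh_chain_shift_integral_mode hw0 hmax hF hC b]
  ring

omit [MeasurableSingletonClass Ω] in
/-- **Two-sided envelope**: `|E_{x₀}[F(X_{b+·})] − E_π[F]| ≤ r^b·|E_{x₀}[F] − E_π[F]| ≤ r^b·2C`. [ours] -/
theorem imh_chain_shift_integral_mode_abs_le [Fact (Measurable w)] (hw0 : ∀ y, 0 < w y) {x₀ : Ω}
    (hmax : ∀ y, w y ≤ w x₀) [IsProbabilityMeasure (q.withDensity fun y => ENNReal.ofReal (w y))]
    {F : (ℕ → Ω) → ℝ} (hF : Measurable F) {C : ℝ} (hC : ∀ x, |F x| ≤ C) (b : ℕ) :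
    |∫ x, F (fun n => x (b + n)) ∂(Kernel.trajMeasure (X := fun _ : ℕ => Ω) (Measure.dirac x₀)
        (fun n : ℕ => (indepMH q w).comap (fun h : (i : ↥(Finset.Iic n)) → Ω => h ⟨n, Finset.mem_Iic.2 le_rfl⟩)
          (measurable_pi_apply _))) -
      ∫ x, F x ∂(Kernel.trajMeasure (X := fun _ : ℕ => Ω) (q.withDensity fun y => ENNReal.ofReal (w y))
        (fun n : ℕ => (indepMH q w).comap (fun h : (i : ↥(Finset.Iic n)) → Ω => h ⟨n, Finset.mem_Iic.2 le_rfl⟩)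
          (measurable_pi_apply _)))| ≤
      (1 - (w x₀)⁻¹) ^ b * (2 * C) := by
  have hW : 1 ≤ w x₀ := one_le_of_mode (q := q) hmax
  have hr0 : 0 ≤ 1 - (w x₀)⁻¹ := sub_nonneg.2 (inv_le_one_of_one_le₀ hW)
  rw [imh_chain_shift_integral_mode_sub_stationary hw0 hmax hF hC b, abs_mul, abs_of_nonneg (pow_nonneg hr0 b)]
  refine mul_le_mul_of_nonneg_left ?_ (pow_nonneg hr0 b)
  have h1 := abs_integral_path_le (Kernel.trajMeasure (X := fun _ : ℕ => Ω) (Measure.dirac x₀)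
    (fun n : ℕ => (indepMH q w).comap (fun h : (i : ↥(Finset.Iic n)) → Ω => h ⟨n, Finset.mem_Iic.2 le_rfl⟩)
      (measurable_pi_apply _))) hC
  have h2 := abs_integral_path_le (Kernel.trajMeasure (X := fun _ : ℕ => Ω)
    (q.withDensity fun y => ENNReal.ofReal (w y))
    (fun n : ℕ => (indepMH q w).comap (fun h : (i : ↥(Finset.Iic n)) → Ω => h ⟨n, Finset.mem_Iic.2 le_rfl⟩)
      (measurable_pi_apply _))) hC
  calc _ ≤ |∫ x, F x ∂(Kernel.trajMeasure (X := fun _ : ℕ => Ω) (Measure.dirac x₀)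
        (fun n : ℕ => (indepMH q w).comap (fun h : (i : ↥(Finset.Iic n)) → Ω => h ⟨n, Finset.mem_Iic.2 le_rfl⟩)
          (measurable_pi_apply _)))| +
      |∫ x, F x ∂(Kernel.trajMeasure (X := fun _ : ℕ => Ω) (q.withDensity fun y => ENNReal.ofReal (w y))
        (fun n : ℕ => (indepMH q w).comap (fun h : (i : ↥(Finset.Iic n)) → Ω => h ⟨n, Finset.mem_Iic.2 le_rfl⟩)
          (measurable_pi_apply _)))| := abs_sub _ _
    _ ≤ C + C := add_le_add h1 h2
    _ = 2 * C := by ring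

omit [MeasurableSingletonClass Ω] in
/-- **THE BURN-IN RULE FOR EVERY STATISTIC**: `log(1/ε) ≤ b/w(x₀)` discarded updates leave at most an `ε`-fraction
of the cold-start distortion: `|E_{x₀}[F(X_{b+·})] − E_π[F]| ≤ ε·|E_{x₀}[F] − E_π[F]|`. [ours] -/
theorem imh_chain_shift_integral_mode_abs_le_of_log_le [Fact (Measurable w)] (hw0 : ∀ y, 0 < w y) {x₀ : Ω}
    (hmax : ∀ y, w y ≤ w x₀) [IsProbabilityMeasure (q.withDensity fun y => ENNReal.ofReal (w y))]
    {F : (ℕ → Ω) → ℝ} (hF : Measurable F) {C : ℝ} (hC : ∀ x, |F x| ≤ C) {b : ℕ} {ε : ℝ} (hε : 0 < ε)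
    (hb : Real.log (1 / ε) ≤ b * (w x₀)⁻¹) :
    |∫ x, F (fun n => x (b + n)) ∂(Kernel.trajMeasure (X := fun _ : ℕ => Ω) (Measure.dirac x₀)
        (fun n : ℕ => (indepMH q w).comap (fun h : (i : ↥(Finset.Iic n)) → Ω => h ⟨n, Finset.mem_Iic.2 le_rfl⟩)
          (measurable_pi_apply _))) -
      ∫ x, F x ∂(Kernel.trajMeasure (X := fun _ : ℕ => Ω) (q.withDensity fun y => ENNReal.ofReal (w y))
        (fun n : ℕ => (indepMH q w).comap (fun h : (i : ↥(Finset.Iic n)) → Ω => h ⟨n, Finset.mem_Iic.2 le_rfl⟩)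
          (measurable_pi_apply _)))| ≤
      ε * |∫ x, F x ∂(Kernel.trajMeasure (X := fun _ : ℕ => Ω) (Measure.dirac x₀)
            (fun n : ℕ => (indepMH q w).comap (fun h : (i : ↥(Finset.Iic n)) → Ω => h ⟨n, Finset.mem_Iic.2 le_rfl⟩)
              (measurable_pi_apply _))) -
          ∫ x, F x ∂(Kernel.trajMeasure (X := fun _ : ℕ => Ω) (q.withDensity fun y => ENNReal.ofReal (w y))
            (fun n : ℕ => (indepMH q w).comap (fun h : (i : ↥(Finset.Iic n)) → Ω => h ⟨n, Finset.mem_Iic.2 le_rfl⟩)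
              (measurable_pi_apply _)))| := by
  have hW : 1 ≤ w x₀ := one_le_of_mode (q := q) hmax
  have hr0 : 0 ≤ 1 - (w x₀)⁻¹ := sub_nonneg.2 (inv_le_one_of_one_le₀ hW)
  rw [imh_chain_shift_integral_mode_sub_stationary hw0 hmax hF hC b, abs_mul, abs_of_nonneg (pow_nonneg hr0 b)]
  exact mul_le_mul_of_nonneg_right (pow_mode_le_of_log_le (q := q) hmax hε hb) (abs_nonneg _)

/-! ## §4 Set form; the exact total variation on path space -/

omit [MeasurableSingletonClass Ω] in
/-- **Set form**: `P_{x₀}(X_{b+·} ∈ E) = (1 − r^b)·P_π(E) + r^b·P_{x₀}(E)` for every measurable set of paths `E`.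
[ours] -/
theorem imh_chain_shift_real_mode [Fact (Measurable w)] (hw0 : ∀ y, 0 < w y) {x₀ : Ω} (hmax : ∀ y, w y ≤ w x₀)
    [IsProbabilityMeasure (q.withDensity fun y => ENNReal.ofReal (w y))] {E : Set (ℕ → Ω)}
    (hE : MeasurableSet E) (b : ℕ) :
    (Kernel.trajMeasure (X := fun _ : ℕ => Ω) (Measure.dirac x₀)
        (fun n : ℕ => (indepMH q w).comap (fun h : (i : ↥(Finset.Iic n)) → Ω => h ⟨n, Finset.mem_Iic.2 le_rfl⟩)
          (measurable_pi_apply _))).real ((fun (x : ℕ → Ω) (n : ℕ) => x (b + n)) ⁻¹' E) =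
      (1 - (1 - (w x₀)⁻¹) ^ b) *
          (Kernel.trajMeasure (X := fun _ : ℕ => Ω) (q.withDensity fun y => ENNReal.ofReal (w y))
            (fun n : ℕ => (indepMH q w).comap (fun h : (i : ↥(Finset.Iic n)) → Ω => h ⟨n, Finset.mem_Iic.2 le_rfl⟩)
              (measurable_pi_apply _))).real E +
        (1 - (w x₀)⁻¹) ^ b *
          (Kernel.trajMeasure (X := fun _ : ℕ => Ω) (Measure.dirac x₀)
            (fun n : ℕ => (indepMH q w).comap (fun h : (i : ↥(Finset.Iic n)) → Ω => h ⟨n, Finset.mem_Iic.2 le_rfl⟩)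
              (measurable_pi_apply _))).real E := by
  have hΘ : Measurable (fun (x : ℕ → Ω) (n : ℕ) => x (b + n)) :=
    measurable_pi_lambda _ fun n => measurable_pi_apply _
  have hb : ∀ x, |E.indicator (1 : (ℕ → Ω) → ℝ) x| ≤ 1 := fun x => by
    by_cases hx : x ∈ E
    · rw [Set.indicator_of_mem hx, Pi.one_apply, abs_one]
    · rw [Set.indicator_of_notMem hx, abs_zero]; exact zero_le_one
  rw [← integral_indicator_one (hΘ hE), ← integral_indicator_one hE, ← integral_indicator_one hE]
  have h := imh_chain_shift_integral_mode (q := q) hw0 hmax (F := E.indicator 1) (measurable_one.indicator hE) hb b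
  refine Eq.trans (integral_congr_ae (ae_of_all _ fun x => ?_)) h
  rfl

omit [MeasurableSingletonClass Ω] in
/-- **`P_{x₀}(X_{b+·} ∈ E) − P_π(E) = r^b·(P_{x₀}(E) − P_π(E))`** for every measurable set of paths. [ours] -/
theorem imh_chain_shift_real_mode_sub_stationary [Fact (Measurable w)] (hw0 : ∀ y, 0 < w y) {x₀ : Ω}
    (hmax : ∀ y, w y ≤ w x₀) [IsProbabilityMeasure (q.withDensity fun y => ENNReal.ofReal (w y))]
    {E : Set (ℕ → Ω)} (hE : MeasurableSet E) (b : ℕ) :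
    (Kernel.trajMeasure (X := fun _ : ℕ => Ω) (Measure.dirac x₀)
        (fun n : ℕ => (indepMH q w).comap (fun h : (i : ↥(Finset.Iic n)) → Ω => h ⟨n, Finset.mem_Iic.2 le_rfl⟩)
          (measurable_pi_apply _))).real ((fun (x : ℕ → Ω) (n : ℕ) => x (b + n)) ⁻¹' E) -
      (Kernel.trajMeasure (X := fun _ : ℕ => Ω) (q.withDensity fun y => ENNReal.ofReal (w y))
        (fun n : ℕ => (indepMH q w).comap (fun h : (i : ↥(Finset.Iic n)) → Ω => h ⟨n, Finset.mem_Iic.2 le_rfl⟩)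
          (measurable_pi_apply _))).real E =
      (1 - (w x₀)⁻¹) ^ b *
        ((Kernel.trajMeasure (X := fun _ : ℕ => Ω) (Measure.dirac x₀)
            (fun n : ℕ => (indepMH q w).comap (fun h : (i : ↥(Finset.Iic n)) → Ω => h ⟨n, Finset.mem_Iic.2 le_rfl⟩)
              (measurable_pi_apply _))).real E -
          (Kernel.trajMeasure (X := fun _ : ℕ => Ω) (q.withDensity fun y => ENNReal.ofReal (w y))
            (fun n : ℕ => (indepMH q w).comap (fun h : (i : ↥(Finset.Iic n)) → Ω => h ⟨n, Finset.mem_Iic.2 le_rfl⟩)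
              (measurable_pi_apply _))).real E) := by
  rw [imh_chain_shift_real_mode hw0 hmax hE b]
  ring

omit [MeasurableSingletonClass Ω] in
/-- **Total variation on path space, upper half**: `|P_{x₀}(X_{b+·} ∈ E) − P_π(E)| ≤ r^b` for every measurable set
of paths `E`. [ours] -/
theorem imh_chain_shift_real_mode_abs_le [Fact (Measurable w)] (hw0 : ∀ y, 0 < w y) {x₀ : Ω}
    (hmax : ∀ y, w y ≤ w x₀) [IsProbabilityMeasure (q.withDensity fun y => ENNReal.ofReal (w y))]
    {E : Set (ℕ → Ω)} (hE : MeasurableSet E) (b : ℕ) :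
    |(Kernel.trajMeasure (X := fun _ : ℕ => Ω) (Measure.dirac x₀)
        (fun n : ℕ => (indepMH q w).comap (fun h : (i : ↥(Finset.Iic n)) → Ω => h ⟨n, Finset.mem_Iic.2 le_rfl⟩)
          (measurable_pi_apply _))).real ((fun (x : ℕ → Ω) (n : ℕ) => x (b + n)) ⁻¹' E) -
      (Kernel.trajMeasure (X := fun _ : ℕ => Ω) (q.withDensity fun y => ENNReal.ofReal (w y))
        (fun n : ℕ => (indepMH q w).comap (fun h : (i : ↥(Finset.Iic n)) → Ω => h ⟨n, Finset.mem_Iic.2 le_rfl⟩)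
          (measurable_pi_apply _))).real E| ≤ (1 - (w x₀)⁻¹) ^ b := by
  have hW : 1 ≤ w x₀ := one_le_of_mode (q := q) hmax
  have hr0 : 0 ≤ 1 - (w x₀)⁻¹ := sub_nonneg.2 (inv_le_one_of_one_le₀ hW)
  rw [imh_chain_shift_real_mode_sub_stationary hw0 hmax hE b, abs_mul, abs_of_nonneg (pow_nonneg hr0 b)]
  refine mul_le_of_le_one_right (pow_nonneg hr0 b) ?_
  rw [abs_sub_le_iff]
  constructor
  · linarith [measureReal_nonneg (μ := Kernel.trajMeasure (X := fun _ : ℕ => Ω)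
        (q.withDensity fun y => ENNReal.ofReal (w y))
        (fun n : ℕ => (indepMH q w).comap (fun h : (i : ↥(Finset.Iic n)) → Ω => h ⟨n, Finset.mem_Iic.2 le_rfl⟩)
          (measurable_pi_apply _))) (s := E),
      measureReal_le_one (μ := Kernel.trajMeasure (X := fun _ : ℕ => Ω) (Measure.dirac x₀)
        (fun n : ℕ => (indepMH q w).comap (fun h : (i : ↥(Finset.Iic n)) → Ω => h ⟨n, Finset.mem_Iic.2 le_rfl⟩)
          (measurable_pi_apply _))) (s := E)]
  · linarith [measureReal_nonneg (μ := Kernel.trajMeasure (X := fun _ : ℕ => Ω) (Measure.dirac x₀)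
        (fun n : ℕ => (indepMH q w).comap (fun h : (i : ↥(Finset.Iic n)) → Ω => h ⟨n, Finset.mem_Iic.2 le_rfl⟩)
          (measurable_pi_apply _))) (s := E),
      measureReal_le_one (μ := Kernel.trajMeasure (X := fun _ : ℕ => Ω)
        (q.withDensity fun y => ENNReal.ofReal (w y))
        (fun n : ℕ => (indepMH q w).comap (fun h : (i : ↥(Finset.Iic n)) → Ω => h ⟨n, Finset.mem_Iic.2 le_rfl⟩)
          (measurable_pi_apply _))) (s := E)]

/-- **THE EXACT TOTAL VARIATION ON PATH SPACE IS `r^b`** (atom-free proposal, `q{x₀} = 0`): at `E = {X_0 = x₀}` the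
bound is attained, `P_{x₀}(X_b = x₀) − P_π(X_0 = x₀) = r^b` — the law of the whole future after `b` discarded updates
is exactly as far from the equilibrium run as the current configuration is from `π`. [ours] -/
theorem imh_chain_shift_atMode_sub_stationary [Fact (Measurable w)] (hw0 : ∀ y, 0 < w y) {x₀ : Ω}
    (hmax : ∀ y, w y ≤ w x₀) (hqx : q {x₀} = 0)
    [IsProbabilityMeasure (q.withDensity fun y => ENNReal.ofReal (w y))] (b : ℕ) :
    (Kernel.trajMeasure (X := fun _ : ℕ => Ω) (Measure.dirac x₀)
        (fun n : ℕ => (indepMH q w).comap (fun h : (i : ↥(Finset.Iic n)) → Ω => h ⟨n, Finset.mem_Iic.2 le_rfl⟩)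
          (measurable_pi_apply _))).real
        ((fun (x : ℕ → Ω) (n : ℕ) => x (b + n)) ⁻¹' {x : ℕ → Ω | x 0 ∈ ({x₀} : Set Ω)}) -
      (Kernel.trajMeasure (X := fun _ : ℕ => Ω) (q.withDensity fun y => ENNReal.ofReal (w y))
        (fun n : ℕ => (indepMH q w).comap (fun h : (i : ↥(Finset.Iic n)) → Ω => h ⟨n, Finset.mem_Iic.2 le_rfl⟩)
          (measurable_pi_apply _))).real {x : ℕ → Ω | x 0 ∈ ({x₀} : Set Ω)} = (1 - (w x₀)⁻¹) ^ b := by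
  have hE : MeasurableSet {x : ℕ → Ω | x 0 ∈ ({x₀} : Set Ω)} :=
    (measurable_pi_apply 0) (measurableSet_singleton x₀)
  have h0 : ∀ (μ₀ : Measure Ω) [IsProbabilityMeasure μ₀],
      (Kernel.trajMeasure (X := fun _ : ℕ => Ω) μ₀
        (fun n : ℕ => (indepMH q w).comap (fun h : (i : ↥(Finset.Iic n)) → Ω => h ⟨n, Finset.mem_Iic.2 le_rfl⟩)
          (measurable_pi_apply _))).real {x : ℕ → Ω | x 0 ∈ ({x₀} : Set Ω)} = μ₀.real {x₀} := by
    intro μ₀ _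
    rw [show {x : ℕ → Ω | x 0 ∈ ({x₀} : Set Ω)} = (fun x : ℕ → Ω => x 0) ⁻¹' {x₀} from rfl,
      ← map_measureReal_apply (measurable_pi_apply 0) (measurableSet_singleton x₀),
      chain_map_eval_zero (indepMH q w) μ₀]
  have hπ0 : (q.withDensity fun y => ENNReal.ofReal (w y)) {x₀} = 0 := withDensity_singleton_eq_zero hqx
  rw [imh_chain_shift_real_mode_sub_stationary hw0 hmax hE b, h0, h0, Measure.real, Measure.real,
    Measure.dirac_apply' x₀ (measurableSet_singleton x₀), Set.indicator_of_mem (Set.mem_singleton x₀),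
    Pi.one_apply, ENNReal.toReal_one, hπ0, ENNReal.toReal_zero, sub_zero, mul_one]

end Summit.Ventures.LatticeQCDFlow.Exactness
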